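import Summits.QuantumFields.YangMills.Theorems.UnitScaleTiltProp7CovariantCurlGaugeComparison
import HarnessLib

/-!
# Route `UnitScaleTilt`, crux K1 «MinimiserStabilityRegPr» (stmt-QuantumFields-19200), EX row `hGF` (curved member), the LOD line (★p1 g24 `LOCATE-L6-ASSEMBLY` §1
# Step I.2, ★★OWNER RULINGS №33 ∕ №34) — **PEN (L5a), FILE B (THE ROW): THE LOCAL GAUGE COMPARISON OF THE HESSIAN TERM `re⟪A, Δ^η(U₀)A⟫`** —
# `|re⟪X̃, Δ^η(U₀)X̃⟫ − re⟪Ỹ, Δ^η(1)Ỹ⟫| ≤ θ·re⟪Ỹ, Δ^η(1)Ỹ⟫ + (1 + θ⁻¹)·16·(η⁻¹δ)²·‖X̃‖² + 1029ε₀·‖X̃‖²`, `Y = Ad_σX`, on `RegPr F n K ε₀ U₀`, whenever the gauged background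
# `U₀^σ` is `δ`-flat on the plaquette edges ADJACENT to `supp X` (and the variant with the curved main term `θ·re⟪X̃, Δ^η(U₀)X̃⟫`, curvature cost `(1+θ)·1029ε₀`)

Cell `ym3-torus` (HUMAN RULING D-0037: YM₃ on T³ is ladder rung R3 — NOT d = 4, NOT infinite volume, NOT a mass gap, NOT Clay).  Twin-width seat `ym-ust-19200-w7` (gen 11);
pen (L5a) assigned by the chair ★p1 g24 2026-08-29 23:14Z; LOCATE `LOCATE-L5a-w7g11.md` c2faf3f7 (19200 evidence #59).  THEOREMS ONLY (0 `def`, 0 `sorry`);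
`--supports stmt-QuantumFields-19200 --as helper`, count-neutral.  HONEST LABEL (№33 (6)): a supplier row of the curved γ-row line (LOD localisation), the `Δ^η` third of pen (L5)
(`D*` third = px12 g13's ✓`Prop7LocalDivergenceComparison` (L5b) — SAME letters `σ`, `Ad_σX`, so the (L6) assembler uses ONE `σ` —, `Q_k` third = routeR-w4 g25's (L5c)); CONDITIONAL on
nothing displayed (the axial-gauge smallness `hV` is a hypothesis inhabited on a cube by [Balaban1985RegularSpaces] Lemma 1, supplied by the (L6) assembler with the cube letters);
nothing of (3.49), Thm 3.3∕3.11, `hGF`, `h349`, EX or the crux proved.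

THE ROW (FILE A ✓∕⧗`Prop7CovariantCurlGaugeComparison` supplies every letter): with `CURL_W(X) = Σ_{posPlaq}‖(D¹_WX)(p)‖_F²`,
`re⟪X̃, Δ^η(U₀)X̃⟫ − re⟪Ỹ, Δ^η(1)Ỹ⟫ = c₀η⁻²·(CURL_{U₀^σ}(Y) − CURL_1(Y)) + c₀η⁻²·P_{U₀}(X)` (covariance `CURL_{U₀}(X) = CURL_{U₀^σ}(Ad_σX)`, flat `P_1 = 0`); the squares row
termwise on the plaquettes (px12's ✓`abs_sq_norm_sub_sq_norm_le` in the fibre `W₂`) and FILE A's closeness `Σ‖(D¹_{U₀^σ} − D¹_1)Y‖_F² ≤ 16δ²Σ‖Y‖_F²` give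
`c₀η⁻²|CURL_{U₀^σ}(Y) − CURL_1(Y)| ≤ θ·re⟪Ỹ, Δ^η(1)Ỹ⟫ + (1 + θ⁻¹)·16η⁻²δ²·‖X̃‖²` (`c₀Σ‖Y‖_F² = ‖X̃‖²`), and `c₀η⁻²|P_{U₀}(X)| ≤ 1029ε₀‖X̃‖²`.  At the member of the line: `σ = g_j` the
axial gauge of `U₀` on the cube `□̃_j ⊋ □_j ⊇ supp A_j`, `δ = 2R″ε₀η` ⟹ `16(η⁻¹δ)² = 64R″²ε₀²` — the `C_θ(ε₀R″)²` of the LOCATE, K-∕volume-free (★p1 g24's currency note 23:14Z: main term and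
error scale identically).

WHAT IS PROVED (ns `…Theorems.Prop7LocalHessianComparison`): `abs_sum_sq_sub_sum_sq_le` (squares row summed over a finite family in `W₂`), ★★★`abs_re_inner_DeltaEta_sub_flat_conj_le`
(flat main term), ★★★`abs_re_inner_DeltaEta_sub_flat_conj_le'` (curved main term).
HONEST SCOPE.  Bookkeeping over FILE A and px12's (L5b) letters; no estimate of Bałaban's is asserted beyond the cited tree theorems.

References: T. Bałaban, CMP **99** (1985) 389–434 [Balaban1985BackgroundPropagators] ((3.4) p.391, (3.10)–(3.12) p.392, p.393, (3.69) p.404); CMP **99** (1985) 75–102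
[Balaban1985RegularSpaces] (Lemma 1 (1.25) p.79); CMP **98** (1985) 17–51 [Balaban1985Averaging] ((18)–(20) p.21).
-/

set_option autoImplicit false

noncomputable section

open scoped Matrix.Norms.L2Operator BigOperators Matrix InnerProductSpace ComplexConjugate

namespace Summit.QuantumFields.YangMills.Theorems.Prop7LocalHessianComparison

open Literature.MathematicalPhysics.QuantumFieldTheory.Balaban1983to89
open Literature.MathematicalPhysics.QuantumFieldTheory.Balaban1983to89.T3ContinuumYM3Torus
open Literature.MathematicalPhysics.QuantumFieldTheory.Balaban1983to89.T3PrintedRegularMinimiser (RegPr regPr_one)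
open T3SectALandauChart (formComp bgUnits covCodiffCurlT eta eta_pos)
open B9Eq39Adjoint (R R_def covD curl posPlaq)
open B9Eq310Hermitian (deltaPrimeOp)
open B10Eq27TorusAxialLog (unitsField toUField unitsField_mem_unitaryUnits)
open B9TorusCalculus (torusT torusT_apply)
open B11Eq103H1Complex (BondL2K)
open Summit.QuantumFields.YangMills.Theorems.Prop7SectET3Transport (periodsT3)
open Summit.QuantumFields.YangMills.Theorems.Prop7SectET3HilbertLetters (W₂ frobEquiv toL2)
open Summit.QuantumFields.YangMills.Theorems.Prop7SectET3WilsonHessian (DeltaEta)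
open Summit.QuantumFields.YangMills.Theorems.Prop7CovariantCoercivity (coe_inv_eq_star)
open Summit.QuantumFields.YangMills.Theorems.Prop7RieszTauFrobNorm (norm_sq_frobEquiv_symm)
open Summit.QuantumFields.YangMills.Theorems.Prop7DeltaEtaAlmostPositive (re_inner_DeltaEta_toL2_eq sum_trace_conjTranspose_mul_covCodiffCurlT_eq_sum_sq norm_toL2_sq)
open Summit.QuantumFields.YangMills.Theorems.Prop7DeltaPrimeL2Bound (norm_sum_trace_conjTranspose_mul_deltaPrimeOp_le)
open Summit.QuantumFields.YangMills.Theorems.Prop7LocalDivergenceComparison (abs_sq_norm_sub_sq_norm_le sum_normSq_mul_le_opNorm_sq_mul sum_normSq_mul_le_mul_opNorm_sq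
  sum_normSq_add_le sum_normSq_conj_eq norm_toL2_conj_eq)

open Summit.QuantumFields.YangMills.Theorems.Prop7CovariantCurlGaugeComparison (curlSq_gaugeAct_conj_eq curlSq_sub_le re_inner_DeltaEta_toL2_eq_curlSq_add
  abs_curvPart_le re_inner_DeltaEta_one_toL2_eq_curlSq sum_norm_sq_frobEquiv_symm_eq)

/-! ## §4 ★★★ The (L5a) rows -/

section Row

variable (F : T3Family) (n K : ℕ) (c₀ : ℝ) [Fact (0 < c₀)]

/-- **THE SQUARES ROW ON THE PLAQUETTES, SUMMED**: for two families `u v` in the fibre, `|Σ_q ‖u_q‖² − Σ_q ‖v_q‖²| ≤ θ·Σ_q ‖v_q‖² + (1 + θ⁻¹)·Σ_q ‖u_q − v_q‖²` (px12's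
✓`abs_sq_norm_sub_sq_norm_le` termwise, main term on the SECOND family). [folklore] -/
theorem abs_sum_sq_sub_sum_sq_le {ι : Type*} (s : Finset ι) (u v : ι → W₂) {θ : ℝ} (hθ : 0 < θ) :
    |∑ q ∈ s, ‖u q‖ ^ 2 - ∑ q ∈ s, ‖v q‖ ^ 2| ≤ θ * ∑ q ∈ s, ‖v q‖ ^ 2 + (1 + θ⁻¹) * ∑ q ∈ s, ‖u q - v q‖ ^ 2 := by
  rw [← Finset.sum_sub_distrib, Finset.mul_sum, Finset.mul_sum, ← Finset.sum_add_distrib]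
  refine (Finset.abs_sum_le_sum_abs _ _).trans (Finset.sum_le_sum fun q _ => ?_)
  rw [abs_sub_comm, norm_sub_rev]
  exact abs_sq_norm_sub_sq_norm_le (v q) (u q) hθ

/-- ★★★ **PEN (L5a) — THE LOCAL GAUGE COMPARISON OF THE HESSIAN TERM, FLAT MAIN TERM.**  For a background `U₀` on `RegPr F n K ε₀ U₀`, a gauge transformation `σ` whose gauged background
`U₀^σ = GaugeField.gaugeAct σ U₀` satisfies `‖U₀^σ(x,μ) − 1‖ ≤ δ` on every edge `⟨x, μ⟩` ADJACENT to the support of `X` (whenever `X(x + e_μ, ν) ≠ 0` for some `ν ≠ μ`; at the member: the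
axial gauge of `U₀` on the cube `□̃_j ⊋ □_j ⊇ supp A_j`, `δ = 2R″ε₀η`), the conjugated one-form `Y = Ad_σX`, `Y(b) = σ(b₋)X(b)σ(b₋)*`, and any `θ > 0`:
`|re⟪X̃, Δ^η(U₀)X̃⟫ − re⟪Ỹ, Δ^η(1)Ỹ⟫| ≤ θ·re⟪Ỹ, Δ^η(1)Ỹ⟫ + (1 + θ⁻¹)·(16·η⁻²·δ²)·‖X̃‖² + 1029·ε₀·‖X̃‖²` — at `δ = 2R″ε₀η` the middle constant is `64R″²ε₀²`, K- and volume-free.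
[cite: Balaban1985BackgroundPropagators, (3.4) p.391, (3.10)–(3.12) p.392, p.393, (3.69) p.404; Balaban1985RegularSpaces, Lemma 1 (1.25) p.79] -/
theorem abs_re_inner_DeltaEta_sub_flat_conj_le {ε₀ : ℝ} (hε₀ : 0 ≤ ε₀) (σ : GaugeTransf (F.P K) 0 (Matrix.specialUnitaryGroup (Fin 2) ℂ))
    (U₀ : GaugeField (F.P K) 0 (Matrix.specialUnitaryGroup (Fin 2) ℂ)) (hreg : RegPr F n K ε₀ U₀) (X : PBond (F.P K) 0 → Matrix (Fin 2) (Fin 2) ℂ) {δ θ : ℝ} (hθ : 0 < θ)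
    (hV : ∀ (x : Site (F.P K) 0) (μ ν : Fin (F.P K).d), μ ≠ ν → X ⟨x.shift μ, ν⟩ ≠ 0 →
      ‖((GaugeField.gaugeAct σ U₀ ⟨x, μ⟩ : Matrix.specialUnitaryGroup (Fin 2) ℂ) : Matrix (Fin 2) (Fin 2) ℂ) - 1‖ ≤ δ) :
    |RCLike.re ⟪toL2 F K c₀ X, DeltaEta F n K c₀ U₀ (toL2 F K c₀ X)⟫_ℂ
        - RCLike.re ⟪toL2 F K c₀ (fun b => (σ b.src : Matrix (Fin 2) (Fin 2) ℂ) * X b * star (σ b.src : Matrix (Fin 2) (Fin 2) ℂ)),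
            DeltaEta F n K c₀ 1 (toL2 F K c₀ (fun b => (σ b.src : Matrix (Fin 2) (Fin 2) ℂ) * X b * star (σ b.src : Matrix (Fin 2) (Fin 2) ℂ)))⟫_ℂ|
      ≤ θ * RCLike.re ⟪toL2 F K c₀ (fun b => (σ b.src : Matrix (Fin 2) (Fin 2) ℂ) * X b * star (σ b.src : Matrix (Fin 2) (Fin 2) ℂ)),
            DeltaEta F n K c₀ 1 (toL2 F K c₀ (fun b => (σ b.src : Matrix (Fin 2) (Fin 2) ℂ) * X b * star (σ b.src : Matrix (Fin 2) (Fin 2) ℂ)))⟫_ℂ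
        + (1 + θ⁻¹) * (16 * ((eta F n K)⁻¹) ^ 2 * δ ^ 2) * ‖toL2 F K c₀ X‖ ^ 2 + 1029 * ε₀ * ‖toL2 F K c₀ X‖ ^ 2 := by
  have hc₀ : 0 < c₀ := Fact.out
  have hη : 0 < eta F n K := eta_pos F n K
  set Y : PBond (F.P K) 0 → Matrix (Fin 2) (Fin 2) ℂ := fun b => (σ b.src : Matrix (Fin 2) (Fin 2) ℂ) * X b * star (σ b.src : Matrix (Fin 2) (Fin 2) ℂ) with hY
  set V : GaugeField (F.P K) 0 (Matrix.specialUnitaryGroup (Fin 2) ℂ) := GaugeField.gaugeAct σ U₀ with hVdef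
  -- the three sums of squares and the curvature part
  set CU : ℝ := ∑ q ∈ posPlaq (Site (F.P K) 0) (Fin (F.P K).d),
      ‖(frobEquiv.symm (curl (torusT (F.P K) 0) (fun μ x => bgUnits F K U₀ ⟨x, μ⟩) (formComp X) q.2.1 q.2.2 q.1) : W₂)‖ ^ 2 with hCU
  set u : Site (F.P K) 0 × Fin (F.P K).d × Fin (F.P K).d → W₂ := fun q =>
      frobEquiv.symm (curl (torusT (F.P K) 0) (fun μ x => bgUnits F K V ⟨x, μ⟩) (formComp Y) q.2.1 q.2.2 q.1) with hu
  set v : Site (F.P K) 0 × Fin (F.P K).d × Fin (F.P K).d → W₂ := fun q =>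
      frobEquiv.symm (curl (torusT (F.P K) 0) (fun μ x => bgUnits F K (1 : GaugeField (F.P K) 0 (Matrix.specialUnitaryGroup (Fin 2) ℂ)) ⟨x, μ⟩) (formComp Y) q.2.1 q.2.2 q.1)
    with hv
  set P : ℝ := (∑ b : PBond (F.P K) 0, Matrix.trace ((X b).conjTranspose
        * deltaPrimeOp (torusT (F.P K) 0) (fun μ x => bgUnits F K U₀ ⟨x, μ⟩) 1 (formComp X) b.dir b.src)).re with hPdef
  set SX : ℝ := ∑ b : PBond (F.P K) 0, ‖(frobEquiv.symm (X b) : W₂)‖ ^ 2 with hSX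
  -- the two Hessian forms in real letters
  have hL : RCLike.re ⟪toL2 F K c₀ X, DeltaEta F n K c₀ U₀ (toL2 F K c₀ X)⟫_ℂ = c₀ * (eta F n K)⁻¹ ^ 2 * (CU + P) :=
    re_inner_DeltaEta_toL2_eq_curlSq_add U₀ X
  have hR : RCLike.re ⟪toL2 F K c₀ Y, DeltaEta F n K c₀ 1 (toL2 F K c₀ Y)⟫_ℂ = c₀ * (eta F n K)⁻¹ ^ 2 * ∑ q ∈ posPlaq (Site (F.P K) 0) (Fin (F.P K).d), ‖v q‖ ^ 2 :=
    re_inner_DeltaEta_one_toL2_eq_curlSq Y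
  -- gauge covariance: `CURL_{U₀}(X) = CURL_{U₀^σ}(Ad_σX)`
  have hcov : CU = ∑ q ∈ posPlaq (Site (F.P K) 0) (Fin (F.P K).d), ‖u q‖ ^ 2 := by
    rw [hCU, hu]
    exact (curlSq_gaugeAct_conj_eq σ U₀ X).symm
  -- closeness on the adjacent-edge row (transported to `Y`: `supp Y = supp X`)
  have hVY : ∀ (x : Site (F.P K) 0) (μ ν : Fin (F.P K).d), μ ≠ ν → Y ⟨x.shift μ, ν⟩ ≠ 0 → ‖(V ⟨x, μ⟩ : Matrix (Fin 2) (Fin 2) ℂ) - 1‖ ≤ δ := by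
    intro x μ ν hμν hYb
    refine hV x μ ν hμν fun h0 => hYb ?_
    simp [hY, h0]
  have hclose : ∑ q ∈ posPlaq (Site (F.P K) 0) (Fin (F.P K).d), ‖u q - v q‖ ^ 2 ≤ 16 * δ ^ 2 * SX := by
    have h1 := curlSq_sub_le V Y hVY
    have h2 : ∑ b : PBond (F.P K) 0, ∑ j, ∑ k, ‖Y b j k‖ ^ 2 = SX := by
      rw [hSX, sum_norm_sq_frobEquiv_symm_eq]
      exact Finset.sum_congr rfl fun b _ => sum_normSq_conj_eq (σ b.src) (X b)
    rw [h2] at h1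
    refine le_of_eq_of_le (Finset.sum_congr rfl fun q _ => ?_) h1
    rw [hu, hv, ← map_sub]
  -- the curvature part at `U₀`
  have hP : |P| ≤ 1029 * (ε₀ * eta F n K ^ 2) * SX := abs_curvPart_le hε₀ U₀ hreg X
  -- the norm of `X̃`
  have hnorm : ‖toL2 F K c₀ X‖ ^ 2 = c₀ * SX := norm_toL2_sq X
  -- squares row summed
  have hsq := abs_sum_sq_sub_sum_sq_le (posPlaq (Site (F.P K) 0) (Fin (F.P K).d)) u v hθ
  have hθ' : 0 ≤ 1 + θ⁻¹ := by positivity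
  have hk : 0 ≤ c₀ * (eta F n K)⁻¹ ^ 2 := by positivity
  have hSX0 : 0 ≤ SX := Finset.sum_nonneg fun b _ => sq_nonneg _
  have hv0 : 0 ≤ ∑ q ∈ posPlaq (Site (F.P K) 0) (Fin (F.P K).d), ‖v q‖ ^ 2 := Finset.sum_nonneg fun q _ => sq_nonneg _
  rw [hL, hR, hcov, hnorm]
  have hηη : (eta F n K)⁻¹ ^ 2 * eta F n K ^ 2 = 1 := by rw [← mul_pow, inv_mul_cancel₀ hη.ne', one_pow]
  calc |c₀ * (eta F n K)⁻¹ ^ 2 * (∑ q ∈ posPlaq (Site (F.P K) 0) (Fin (F.P K).d), ‖u q‖ ^ 2 + P)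
          - c₀ * (eta F n K)⁻¹ ^ 2 * ∑ q ∈ posPlaq (Site (F.P K) 0) (Fin (F.P K).d), ‖v q‖ ^ 2|
        = c₀ * (eta F n K)⁻¹ ^ 2 * |(∑ q ∈ posPlaq (Site (F.P K) 0) (Fin (F.P K).d), ‖u q‖ ^ 2
            - ∑ q ∈ posPlaq (Site (F.P K) 0) (Fin (F.P K).d), ‖v q‖ ^ 2) + P| := by
          rw [← abs_of_nonneg hk, ← abs_mul, abs_of_nonneg hk]; ring_nf
    _ ≤ c₀ * (eta F n K)⁻¹ ^ 2 * ((θ * ∑ q ∈ posPlaq (Site (F.P K) 0) (Fin (F.P K).d), ‖v q‖ ^ 2 + (1 + θ⁻¹) * (16 * δ ^ 2 * SX))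
            + 1029 * (ε₀ * eta F n K ^ 2) * SX) := by
          refine mul_le_mul_of_nonneg_left ((abs_add_le _ _).trans (add_le_add (hsq.trans ?_) hP)) hk
          exact add_le_add_right (mul_le_mul_of_nonneg_left hclose hθ') _
    _ = θ * (c₀ * (eta F n K)⁻¹ ^ 2 * ∑ q ∈ posPlaq (Site (F.P K) 0) (Fin (F.P K).d), ‖v q‖ ^ 2)
          + (1 + θ⁻¹) * (16 * (eta F n K)⁻¹ ^ 2 * δ ^ 2) * (c₀ * SX) + 1029 * ε₀ * (c₀ * SX) * ((eta F n K)⁻¹ ^ 2 * eta F n K ^ 2) := by ring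
    _ = _ := by rw [hηη, mul_one]

/-- ★★★ **PEN (L5a), CURVED MAIN TERM** (assembler's alternative): same hypotheses,
`|re⟪X̃, Δ^η(U₀)X̃⟫ − re⟪Ỹ, Δ^η(1)Ỹ⟫| ≤ θ·re⟪X̃, Δ^η(U₀)X̃⟫ + (1 + θ⁻¹)·(16·η⁻²·δ²)·‖X̃‖² + (1 + θ)·1029·ε₀·‖X̃‖²` (the curved curl energy is `re⟪X̃, Δ^η(U₀)X̃⟫` up to the
curvature part, which costs another `θ·1029ε₀`). [cite: Balaban1985BackgroundPropagators, (3.4) p.391, (3.10)–(3.12) p.392, p.393, (3.69) p.404; Balaban1985RegularSpaces, Lemma 1 (1.25) p.79] -/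
theorem abs_re_inner_DeltaEta_sub_flat_conj_le' {ε₀ : ℝ} (hε₀ : 0 ≤ ε₀) (σ : GaugeTransf (F.P K) 0 (Matrix.specialUnitaryGroup (Fin 2) ℂ))
    (U₀ : GaugeField (F.P K) 0 (Matrix.specialUnitaryGroup (Fin 2) ℂ)) (hreg : RegPr F n K ε₀ U₀) (X : PBond (F.P K) 0 → Matrix (Fin 2) (Fin 2) ℂ) {δ θ : ℝ} (hθ : 0 < θ)
    (hV : ∀ (x : Site (F.P K) 0) (μ ν : Fin (F.P K).d), μ ≠ ν → X ⟨x.shift μ, ν⟩ ≠ 0 →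
      ‖((GaugeField.gaugeAct σ U₀ ⟨x, μ⟩ : Matrix.specialUnitaryGroup (Fin 2) ℂ) : Matrix (Fin 2) (Fin 2) ℂ) - 1‖ ≤ δ) :
    |RCLike.re ⟪toL2 F K c₀ X, DeltaEta F n K c₀ U₀ (toL2 F K c₀ X)⟫_ℂ
        - RCLike.re ⟪toL2 F K c₀ (fun b => (σ b.src : Matrix (Fin 2) (Fin 2) ℂ) * X b * star (σ b.src : Matrix (Fin 2) (Fin 2) ℂ)),
            DeltaEta F n K c₀ 1 (toL2 F K c₀ (fun b => (σ b.src : Matrix (Fin 2) (Fin 2) ℂ) * X b * star (σ b.src : Matrix (Fin 2) (Fin 2) ℂ)))⟫_ℂ|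
      ≤ θ * RCLike.re ⟪toL2 F K c₀ X, DeltaEta F n K c₀ U₀ (toL2 F K c₀ X)⟫_ℂ
        + (1 + θ⁻¹) * (16 * ((eta F n K)⁻¹) ^ 2 * δ ^ 2) * ‖toL2 F K c₀ X‖ ^ 2 + (1 + θ) * (1029 * ε₀) * ‖toL2 F K c₀ X‖ ^ 2 := by
  -- the curved dictionary `a = c₀η⁻²(CURL_{U₀}(X) + P)`, the flat one `b = c₀η⁻²CURL_1(Y)`; squares row with the main term on the FIRST (curved) family; `−θ·c₀η⁻²P ≤ θ·1029ε₀‖X̃‖²`.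
  have hc₀ : 0 < c₀ := Fact.out
  have hη : 0 < eta F n K := eta_pos F n K
  have hk : 0 ≤ c₀ * (eta F n K)⁻¹ ^ 2 := by positivity
  set Y : PBond (F.P K) 0 → Matrix (Fin 2) (Fin 2) ℂ := fun b => (σ b.src : Matrix (Fin 2) (Fin 2) ℂ) * X b * star (σ b.src : Matrix (Fin 2) (Fin 2) ℂ) with hY
  set V : GaugeField (F.P K) 0 (Matrix.specialUnitaryGroup (Fin 2) ℂ) := GaugeField.gaugeAct σ U₀ with hVdef
  set u : Site (F.P K) 0 × Fin (F.P K).d × Fin (F.P K).d → W₂ := fun q =>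
      frobEquiv.symm (curl (torusT (F.P K) 0) (fun μ x => bgUnits F K V ⟨x, μ⟩) (formComp Y) q.2.1 q.2.2 q.1) with hu
  set v : Site (F.P K) 0 × Fin (F.P K).d × Fin (F.P K).d → W₂ := fun q =>
      frobEquiv.symm (curl (torusT (F.P K) 0) (fun μ x => bgUnits F K (1 : GaugeField (F.P K) 0 (Matrix.specialUnitaryGroup (Fin 2) ℂ)) ⟨x, μ⟩) (formComp Y) q.2.1 q.2.2 q.1)
    with hv
  set P : ℝ := (∑ b : PBond (F.P K) 0, Matrix.trace ((X b).conjTranspose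
        * deltaPrimeOp (torusT (F.P K) 0) (fun μ x => bgUnits F K U₀ ⟨x, μ⟩) 1 (formComp X) b.dir b.src)).re with hPdef
  set SX : ℝ := ∑ b : PBond (F.P K) 0, ‖(frobEquiv.symm (X b) : W₂)‖ ^ 2 with hSX
  have hL : RCLike.re ⟪toL2 F K c₀ X, DeltaEta F n K c₀ U₀ (toL2 F K c₀ X)⟫_ℂ
      = c₀ * (eta F n K)⁻¹ ^ 2 * ((∑ q ∈ posPlaq (Site (F.P K) 0) (Fin (F.P K).d), ‖u q‖ ^ 2) + P) := by
    rw [re_inner_DeltaEta_toL2_eq_curlSq_add U₀ X, ← curlSq_gaugeAct_conj_eq σ U₀ X]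
  have hR : RCLike.re ⟪toL2 F K c₀ Y, DeltaEta F n K c₀ 1 (toL2 F K c₀ Y)⟫_ℂ = c₀ * (eta F n K)⁻¹ ^ 2 * ∑ q ∈ posPlaq (Site (F.P K) 0) (Fin (F.P K).d), ‖v q‖ ^ 2 :=
    re_inner_DeltaEta_one_toL2_eq_curlSq Y
  have hVY : ∀ (x : Site (F.P K) 0) (μ ν : Fin (F.P K).d), μ ≠ ν → Y ⟨x.shift μ, ν⟩ ≠ 0 → ‖(V ⟨x, μ⟩ : Matrix (Fin 2) (Fin 2) ℂ) - 1‖ ≤ δ := by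
    intro x μ ν hμν hYb
    refine hV x μ ν hμν fun h0 => hYb ?_
    simp [hY, h0]
  have hclose : ∑ q ∈ posPlaq (Site (F.P K) 0) (Fin (F.P K).d), ‖u q - v q‖ ^ 2 ≤ 16 * δ ^ 2 * SX := by
    have h1 := curlSq_sub_le V Y hVY
    have h2 : ∑ b : PBond (F.P K) 0, ∑ j, ∑ k, ‖Y b j k‖ ^ 2 = SX := by
      rw [hSX, sum_norm_sq_frobEquiv_symm_eq]
      exact Finset.sum_congr rfl fun b _ => sum_normSq_conj_eq (σ b.src) (X b)
    rw [h2] at h1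
    refine le_of_eq_of_le (Finset.sum_congr rfl fun q _ => ?_) h1
    rw [hu, hv, ← map_sub]
  have hP : |P| ≤ 1029 * (ε₀ * eta F n K ^ 2) * SX := abs_curvPart_le hε₀ U₀ hreg X
  have hnorm : ‖toL2 F K c₀ X‖ ^ 2 = c₀ * SX := norm_toL2_sq X
  -- squares row with the main term on the FIRST (curved) family
  have hsq : |∑ q ∈ posPlaq (Site (F.P K) 0) (Fin (F.P K).d), ‖u q‖ ^ 2 - ∑ q ∈ posPlaq (Site (F.P K) 0) (Fin (F.P K).d), ‖v q‖ ^ 2|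
      ≤ θ * ∑ q ∈ posPlaq (Site (F.P K) 0) (Fin (F.P K).d), ‖u q‖ ^ 2 + (1 + θ⁻¹) * ∑ q ∈ posPlaq (Site (F.P K) 0) (Fin (F.P K).d), ‖u q - v q‖ ^ 2 := by
    rw [← Finset.sum_sub_distrib, Finset.mul_sum, Finset.mul_sum, ← Finset.sum_add_distrib]
    refine (Finset.abs_sum_le_sum_abs _ _).trans (Finset.sum_le_sum fun q _ => ?_)
    exact abs_sq_norm_sub_sq_norm_le (u q) (v q) hθ
  have hθ' : 0 ≤ 1 + θ⁻¹ := by positivity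
  have hSX0 : 0 ≤ SX := Finset.sum_nonneg fun b _ => sq_nonneg _
  have hηη : (eta F n K)⁻¹ ^ 2 * eta F n K ^ 2 = 1 := by rw [← mul_pow, inv_mul_cancel₀ hη.ne', one_pow]
  have hPθ : -(θ * (c₀ * (eta F n K)⁻¹ ^ 2 * P)) ≤ θ * (1029 * ε₀ * (c₀ * SX)) := by
    have h1 : c₀ * (eta F n K)⁻¹ ^ 2 * |P| ≤ c₀ * (eta F n K)⁻¹ ^ 2 * (1029 * (ε₀ * eta F n K ^ 2) * SX) := mul_le_mul_of_nonneg_left hP hk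
    have h2 : c₀ * (eta F n K)⁻¹ ^ 2 * (1029 * (ε₀ * eta F n K ^ 2) * SX) = 1029 * ε₀ * (c₀ * SX) * ((eta F n K)⁻¹ ^ 2 * eta F n K ^ 2) := by ring
    rw [h2, hηη, mul_one] at h1
    have h3 : -(c₀ * (eta F n K)⁻¹ ^ 2 * P) ≤ c₀ * (eta F n K)⁻¹ ^ 2 * |P| := by
      rw [← mul_neg]; exact mul_le_mul_of_nonneg_left (neg_le_abs P) hk
    nlinarith [h1, h3, hθ.le]
  rw [hnorm, hL, hR]
  calc |c₀ * (eta F n K)⁻¹ ^ 2 * (∑ q ∈ posPlaq (Site (F.P K) 0) (Fin (F.P K).d), ‖u q‖ ^ 2 + P)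
          - c₀ * (eta F n K)⁻¹ ^ 2 * ∑ q ∈ posPlaq (Site (F.P K) 0) (Fin (F.P K).d), ‖v q‖ ^ 2|
        = c₀ * (eta F n K)⁻¹ ^ 2 * |(∑ q ∈ posPlaq (Site (F.P K) 0) (Fin (F.P K).d), ‖u q‖ ^ 2
            - ∑ q ∈ posPlaq (Site (F.P K) 0) (Fin (F.P K).d), ‖v q‖ ^ 2) + P| := by
          rw [← abs_of_nonneg hk, ← abs_mul, abs_of_nonneg hk]; ring_nf
    _ ≤ c₀ * (eta F n K)⁻¹ ^ 2 * ((θ * ∑ q ∈ posPlaq (Site (F.P K) 0) (Fin (F.P K).d), ‖u q‖ ^ 2 + (1 + θ⁻¹) * (16 * δ ^ 2 * SX))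
            + 1029 * (ε₀ * eta F n K ^ 2) * SX) := by
          refine mul_le_mul_of_nonneg_left ((abs_add_le _ _).trans (add_le_add (hsq.trans ?_) hP)) hk
          exact add_le_add_right (mul_le_mul_of_nonneg_left hclose hθ') _
    _ = θ * (c₀ * (eta F n K)⁻¹ ^ 2 * ((∑ q ∈ posPlaq (Site (F.P K) 0) (Fin (F.P K).d), ‖u q‖ ^ 2) + P))
          + -(θ * (c₀ * (eta F n K)⁻¹ ^ 2 * P))
          + (1 + θ⁻¹) * (16 * (eta F n K)⁻¹ ^ 2 * δ ^ 2) * (c₀ * SX) + 1029 * ε₀ * (c₀ * SX) * ((eta F n K)⁻¹ ^ 2 * eta F n K ^ 2) := by ring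
    _ ≤ θ * (c₀ * (eta F n K)⁻¹ ^ 2 * ((∑ q ∈ posPlaq (Site (F.P K) 0) (Fin (F.P K).d), ‖u q‖ ^ 2) + P))
          + θ * (1029 * ε₀ * (c₀ * SX))
          + (1 + θ⁻¹) * (16 * (eta F n K)⁻¹ ^ 2 * δ ^ 2) * (c₀ * SX) + 1029 * ε₀ * (c₀ * SX) * ((eta F n K)⁻¹ ^ 2 * eta F n K ^ 2) := by
          gcongr
    _ = _ := by rw [hηη]; ring

end Row

end Summit.QuantumFields.YangMills.Theorems.Prop7LocalHessianComparison

end
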